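import Literature.MathematicalPhysics.QuantumFieldTheory.Balaban1983to89.B1DeltaGDerivRegularRegion
import Literature.MathematicalPhysics.QuantumFieldTheory.Balaban1983to89.B1DeltaGCutoff

/-!
# `Balaban1983to89.B1DeltaGDerivCutoffPairing` — [Balaban1983RegularityDecay] **(1.11) / Cor. 2.3 (2.30) second sentence: the three DERIVATIVE
# pairings of `δG_k(Ω,Ω₀,A) = G_k(Ω,A) − G_k(Ω₀,A)` AT A REGULAR `A` FOR NESTED REGIONS `Ω ⊆ Ω₀` of `T_ε` on the CONCRETE (Higgs)₂,₃ carrier, with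
# the printed decay `exp(−δ₀dist(supp f, Ωᶜ) − δ₀dist(supp f′, Ωᶜ))`** — r14 g15's assembled bounds (`B1DeltaGDerivRegularRegion`, p331270) with
# r14 g14's adapted cutoff (`B1DeltaGCutoff`, p329499); the companion of `B1DeltaGCutoffPairing` (plain pairing, p329907)

statement-level skeleton of published theorems with citation tags; proofs where landed; nothing here is a claim about the Yang–Mills mass gap

PDF held: `paper:balaban1983-cmp89-regularity-decay` p. 573 [PDF 3] ((1.11)–(1.12)), pp. 580–581 [PDF 10–11] (Cor. 2.3).  WHAT IS PRINTED
(verbatim, p. 581 = `cmp89/p0011.txt` L2): *"The same inequalities hold for δG_k(Ω,Ω₀,A) with the additional factor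
e^{−δ₀(dist(supp f,Ωᶜ)+dist(supp f′,Ωᶜ))}."* — the inequalities being (2.30) p. 580: *"|⟨f, G_k(Ω,A)f′⟩|, |⟨f, D^η_{A,μ}G_k(Ω,A)f′⟩|,
|⟨f, G_k(Ω,A)D^{η*}_{A,ν}f′⟩|, |⟨f, D^η_{A,μ}G_k(Ω,A)D^{η*}_{A,ν}f′⟩| ≤ c₀e^{−δ₀dist(supp f, supp f′)}‖f‖₂‖f′‖₂"*.

CITATION HEADER (lean-in-tree rule).  T. Bałaban, *Regularity and decay of lattice Green's functions*, Commun. Math. Phys. **89** (1983) 571–597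
[Balaban1983RegularityDecay], (1.11) p. 573, Cor. 2.3 (2.30) pp. 580–581; [Balaban1982Higgs1] (1.7) p. 605, (2.20)–(2.23) p. 610.  Cell
`lit-balaban`, reader/typer seat **r14** gen 15 (unit `lit-balaban-r14`; TAKING line HOME/STATUS.md 2026-08-22T14:05:59Z; design note
`lit-balaban-r14/DESIGN-deltaG-pairings.md` ADDENDUM step 5); SKELETON rows **B1.Prop2.3 / B1.Prop2.1** (cells) and r01's **B4.Cor2.3** (model-instance
material; no head change).  USED BY NAME, never restated: `B1DeltaGDerivRegularRegion.{deltaG_pairing_DG_of_cutoff, deltaG_pairing_GDt_of_cutoff,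
deltaG_pairing_DGDt_of_cutoff}` (p331270), every §2–§3 lemma of `B1DeltaGCutoff` (p329499), `B2Ineq329ZeroAveraging.mesh_eq`, `B1Cor23RegularDiagFam.adjA`.

WHAT THIS FILE PROVES (kernel-checked, zero `sorry`, three theorems; axioms standard).  For `Ω ⊆ Ω₀` unions of `k`-blocks with a point `z₀ ∉ Ω`,
(2.20)-coercivity `γ` at `A` on the `Ω`- and on the `Ω₀`-supported fields (both from (2.23)-regularity on `Ω₀`, `B1Ineq18RegularRegion.coercive_covOpK_of_reg223`),
admissible `δ`, an integer `M ≥ 1`, bond fields `h, h′` vanishing off the bonds inside `Ω` and site fields `g, g′ ⊂ Ω` whose supports (bond sources)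
are at lattice distance `≥ ρ, ρ′` from `Ωᶜ`:
* **`deltaG_pairing_DG_regular_region`**: `|⟨h, D^ε_A(G^ε_k(Ω,A) − G^ε_k(Ω₀,A))g′⟩| ≤ C₁(M)·e^{2δ(M+3)}·(L^kε)·e^{−δρ/L^k}e^{−δρ′/L^k}‖h‖‖g′‖`;
* **`deltaG_pairing_GDt_regular_region`**: `|⟨g, (G^ε_k(Ω,A) − G^ε_k(Ω₀,A))D^{ε*}_Ah′⟩| ≤ C₁(M)·e^{2δ(M+3)}·(L^kε)·e^{−δρ/L^k}e^{−δρ′/L^k}‖g‖‖h′‖`;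
* **`deltaG_pairing_DGDt_regular_region`**: `|⟨h, D^ε_A(G^ε_k(Ω,A) − G^ε_k(Ω₀,A))D^{ε*}_Ah′⟩| ≤ C₃(M)·e^{2δ(M+3)}·e^{−δρ/L^k}e^{−δρ′/L^k}‖h‖‖h′‖`;
`C₁(M) = c_D(e^{δ}+e^{3δ}) + M^{−1}√d(e^{2δ}(c₂·2/γ + c_D²) + 2/γ) + 2M^{−1}a_kc_De^{δ}·2/γ`, `C₃(M) = c₂(e^{3δ}+e^{4δ}) + M^{−1}√d·c_De^{δ}(2c₂e^{2δ}+2) +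
2M^{−1}a_kc_D²e^{2δ}`, `c_D = 2/√γ + 4√d·δ/γ`, `c₂ = 4 + 2δ(8d/γ)^{1/2}` — UNIFORM IN `k` (take `M = 1`).  Proofs = the `_of_cutoff` theorems with
`χ = cutoff Ωᶜ z₀ M k`, `κ = 1/(ML^k)`, `κ′ = 1/M`, `S = jumpBonds`, `Y = collarBlocks`, `T = transition`, `r = ρ − (M+3)L^k`; `κ·ε^{−1}·(L^kε) = 1/M` by `mesh_eq`.
HONEST SCOPE.  (i) the printed `dist` is the `L^kε`-scaled one; here distances are in lattice steps divided by `L^k` (as in all r14 files), the factor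
`e^{2δ(M+3)} ≤ e^{8}` is explicit; (ii) the joint decay in `dist(supp f, supp f′)` (by `min` with the plain derivative pairings p325528) and the
packaging into `B4.Cor23Printed` for nested pairs are the sibling `B1Cor23RegularNestedFam`; (iii) METHOD divergence from the print (cutoff–commutator
instead of the random walk) as disclosed in `B1DeltaGRegularRegion`; (iv) hypothesis `z₀ ∉ Ω` excludes `Ω = T_ε` (then `Ω₀ = Ω` and `δG = 0`); (v) NOT
summit progress.
-/

noncomputable section

namespace Literature.MathematicalPhysics.QuantumFieldTheory.Balaban1983to89.B1DeltaGDerivCutoffPairing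

open HiggsLattice HiggsAveraging HiggsCovariance HiggsCovariancePos
open B2Ineq329ZeroAveraging (mesh_eq)
open B1DeltaGDerivRegularRegion (deltaG_pairing_DG_of_cutoff deltaG_pairing_GDt_of_cutoff deltaG_pairing_DGDt_of_cutoff)
open B1DeltaGCutoff
open B1Cor23RegularDiagFam (adjA)

variable {P : HiggsLattice.Params} {N : ℕ} {k : ℕ}

/-- the two bookkeeping identities of the instantiation: `κε^{−1}(L^kε) = 1/M` for `κ = 1/(ML^k)`, and
`e^{−δ(ρ − (M+3)L^k)/L^k} = e^{δ(M+3)}e^{−δρ/L^k}`. [folklore] -/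
private theorem bookkeeping (M : ℕ) (hM : 1 ≤ M) (δ : ℝ) :
    1 / ((M : ℝ) * (P.L : ℝ) ^ k) * (P.mesh 0)⁻¹ * P.mesh k = 1 / M ∧
    ∀ ρ₁ : ℝ, Real.exp (-(δ * ((ρ₁ - ((M : ℝ) + 3) * (P.L : ℝ) ^ k) / (P.L : ℝ) ^ k)))
      = Real.exp (δ * ((M : ℝ) + 3)) * Real.exp (-(δ * (ρ₁ / (P.L : ℝ) ^ k))) := by
  have hM' : (0 : ℝ) < M := by exact_mod_cast hM
  have hLk : (0 : ℝ) < (P.L : ℝ) ^ k := pow_pos (by exact_mod_cast P.hL) _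
  have hm0 : 0 < P.mesh 0 := P.mesh_pos 0
  have hmesh : P.mesh k = (P.L : ℝ) ^ k * P.mesh 0 := mesh_eq k
  refine ⟨by rw [hmesh]; field_simp, fun ρ₁ => ?_⟩
  rw [← Real.exp_add]
  congr 1
  field_simp
  ring

set_option maxHeartbeats 800000 in
/-- **[13] (1.11) / Cor. 2.3 (2.30) second sentence — the SECOND `δG` pairing `⟨h, D^ε_A(G^ε_k(Ω,A) − G^ε_k(Ω₀,A))g′⟩` at a regular `A` on the
concrete carrier, PRINTED SHAPE up to the lattice normalisation of distances**: for `Ω ⊆ Ω₀` unions of `k`-blocks with `Ωᶜ ≠ ∅` (an element `z₀ ∉ Ω`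
given), (2.20)-coercivity `γ` at `A` on the `Ω`- and `Ω₀`-supported fields, admissible `δ`, an integer `M ≥ 1`, a bond field `h` vanishing off the bonds
inside `Ω` with sources at lattice distance `≥ ρ` from `Ωᶜ` and a site field `g′ ⊂ Ω` at distance `≥ ρ′` from `Ωᶜ`:
`|⟨h, D^ε_AδG g′⟩| ≤ C₁(M)·e^{2δ(M+3)}·(L^kε)·e^{−δρ/L^k}e^{−δρ′/L^k}‖h‖‖g′‖` — uniform in `k`.
[cite: Balaban1983RegularityDecay, (1.11) p.573, Cor. 2.3 (2.30) pp.580–581] -/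
theorem deltaG_pairing_DG_regular_region (C : ChargeData N) (A : HiggsLattice.VecField P 0) {msq a : ℝ} (hk : k ≤ P.K)
    (Ω Ω₀ : Finset (HiggsLattice.Site P 0))
    (hΩ : ∀ x x' : HiggsLattice.Site P 0, blockIter k x = blockIter k x' → (x ∈ Ω ↔ x' ∈ Ω))
    (hΩ₀ : ∀ x x' : HiggsLattice.Site P 0, blockIter k x = blockIter k x' → (x ∈ Ω₀ ↔ x' ∈ Ω₀)) (hsub : Ω ⊆ Ω₀)
    (z₀ : (Finset.univ.filter fun y : HiggsLattice.Site P 0 => y ∉ Ω))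
    (hmsq : 0 < msq) (hak : 0 ≤ B1.aSeq a P.L k) {γ : ℝ} (hγ : 0 < γ)
    (hlow : ∀ w : ScalarField P 0 N, (∀ x, x ∉ Ω → w x = 0) →
      γ * ((P.mesh k)⁻¹ ^ 2) * siteInner w w ≤ siteInner w (covOpK C Ω A msq a k w))
    (hlow₀ : ∀ w : ScalarField P 0 N, (∀ x, x ∉ Ω₀ → w x = 0) →
      γ * ((P.mesh k)⁻¹ ^ 2) * siteInner w w ≤ siteInner w (covOpK C Ω₀ A msq a k w))
    {δ : ℝ} (hδ0 : 0 ≤ δ) (hδ1 : δ ≤ 1) (hδ : 2 * (2 * P.d * δ ^ 2 + B1.aSeq a P.L k * (2 * δ)) ≤ γ)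
    (M : ℕ) (hM : 1 ≤ M)
    (h : HiggsLattice.PBond P 0 → E N) (hh : ∀ b, ¬ Inside Ω b → h b = 0)
    (g' : ScalarField P 0 N) (hg' : ∀ x, x ∉ Ω → g' x = 0) (ρ ρ' : ℝ)
    (hρ : ∀ b, h b ≠ 0 → ρ ≤ (distTo (Finset.univ.filter fun y : HiggsLattice.Site P 0 => y ∉ Ω) z₀ b.src : ℝ))
    (hρ' : ∀ x, g' x ≠ 0 → ρ' ≤ (distTo (Finset.univ.filter fun y : HiggsLattice.Site P 0 => y ∉ Ω) z₀ x : ℝ)) :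
    |bondInner h (covDeriv C A (propagatorK C Ω A msq a k g')) - bondInner h (covDeriv C A (propagatorK C Ω₀ A msq a k g'))|
      ≤ ((2 / Real.sqrt γ + 4 * Real.sqrt P.d * δ / γ) * (Real.exp δ + Real.exp δ ^ 3)
          + 1 / M * Real.sqrt P.d *
              (Real.exp δ ^ 2 * ((4 + 2 * δ * Real.sqrt (8 * P.d / γ)) * (2 / γ) + (2 / Real.sqrt γ + 4 * Real.sqrt P.d * δ / γ) ^ 2)
                + 2 / γ)
          + 2 * (1 / M) * B1.aSeq a P.L k * (2 / Real.sqrt γ + 4 * Real.sqrt P.d * δ / γ) * Real.exp δ * (2 / γ))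
        * Real.exp (2 * (δ * ((M : ℝ) + 3))) * P.mesh k
        * Real.exp (-(δ * (ρ / (P.L : ℝ) ^ k))) * Real.exp (-(δ * (ρ' / (P.L : ℝ) ^ k)))
        * Real.sqrt (bondInner h h) * Real.sqrt (siteInner g' g') := by
  classical
  set Z : Finset (HiggsLattice.Site P 0) := Finset.univ.filter fun y : HiggsLattice.Site P 0 => y ∉ Ω with hZdef
  have hZΩ : ∀ y, y ∉ Ω → y ∈ Z := fun y hy => Finset.mem_filter.2 ⟨Finset.mem_univ _, hy⟩
  have hM' : (0 : ℝ) < M := by exact_mod_cast hM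
  have hLk : (0 : ℝ) < (P.L : ℝ) ^ k := pow_pos (by exact_mod_cast P.hL) _
  set χ := cutoff Z z₀ M k with hχ
  have H := deltaG_pairing_DG_of_cutoff C A hk Ω Ω₀ hΩ hΩ₀ hsub hmsq hak hγ hlow hlow₀ hδ0 hδ1 hδ χ
    (cutoff_nonneg Z z₀ M k) (cutoff_le_one Z z₀ M k)
    (fun b _ hb => cutoff_boundary_bond Z z₀ M k Ω hZΩ b hb)
    (κ := 1 / ((M : ℝ) * (P.L : ℝ) ^ k)) (by positivity) (abs_cutoff_bond_le Z z₀ M k hM)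
    (jumpBonds Z z₀ M k Ω) (fun b hb => inside_of_mem_jumpBonds Z z₀ M k Ω hb) (fun b hb hj => mem_jumpBonds Z z₀ M k Ω hb hj)
    (κ' := 1 / (M : ℝ)) (by positivity) (fun x x' h0 => abs_cutoff_block_le Z z₀ M k hM hk h0)
    (collarBlocks Z z₀ M k Ω) (fun x x' h0 hy => cutoff_const_off_collarBlocks Z z₀ M k Ω hM hΩ hZΩ h0 hy)
    (transition Z z₀ M k Ω) (fun x hx h0 => mem_transition_of_cutoff_ne_one Z z₀ M k Ω hM hx h0)
    (fun b hb => src_mem_transition_of_mem_jumpBonds Z z₀ M k Ω hM hb) (fun x hx => (mem_transition_iff Z z₀ M k Ω x).2 hx)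
    h hh g' hg' (ρ - ((M : ℝ) + 3) * (P.L : ℝ) ^ k) (ρ' - ((M : ℝ) + 3) * (P.L : ℝ) ^ k)
    (fun b t hb ht => sep_of_le_distTo Z z₀ M k Ω hk (hρ b hb) ht)
    (fun x t hx ht => sep_of_le_distTo Z z₀ M k Ω hk (hρ' x hx) ht)
  obtain ⟨hκ, hexp⟩ := bookkeeping (P := P) (k := k) M hM δ
  rw [hκ, hexp ρ, hexp ρ'] at H
  refine H.trans (le_of_eq ?_)
  have e2 : Real.exp (2 * (δ * ((M : ℝ) + 3))) = Real.exp (δ * ((M : ℝ) + 3)) * Real.exp (δ * ((M : ℝ) + 3)) := by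
    rw [two_mul, Real.exp_add]
  rw [e2]
  ring

set_option maxHeartbeats 800000 in
/-- **[13] (1.11) / Cor. 2.3 (2.30) second sentence — the THIRD `δG` pairing `⟨g, (G^ε_k(Ω,A) − G^ε_k(Ω₀,A))D^{ε*}_Ah′⟩` at a regular `A` on the
concrete carrier, PRINTED SHAPE up to the lattice normalisation of distances** (same data; `g ⊂ Ω` at lattice distance `≥ ρ` from `Ωᶜ`, `h′` on the
bonds inside `Ω` with sources at distance `≥ ρ′`): `|⟨g, δG D^{ε*}_Ah′⟩| ≤ C₁(M)·e^{2δ(M+3)}·(L^kε)·e^{−δρ/L^k}e^{−δρ′/L^k}‖g‖‖h′‖` — uniform in `k`.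
[cite: Balaban1983RegularityDecay, (1.11) p.573, Cor. 2.3 (2.30) pp.580–581] -/
theorem deltaG_pairing_GDt_regular_region (C : ChargeData N) (A : HiggsLattice.VecField P 0) {msq a : ℝ} (hk : k ≤ P.K)
    (Ω Ω₀ : Finset (HiggsLattice.Site P 0))
    (hΩ : ∀ x x' : HiggsLattice.Site P 0, blockIter k x = blockIter k x' → (x ∈ Ω ↔ x' ∈ Ω))
    (hΩ₀ : ∀ x x' : HiggsLattice.Site P 0, blockIter k x = blockIter k x' → (x ∈ Ω₀ ↔ x' ∈ Ω₀)) (hsub : Ω ⊆ Ω₀)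
    (z₀ : (Finset.univ.filter fun y : HiggsLattice.Site P 0 => y ∉ Ω))
    (hmsq : 0 < msq) (hak : 0 ≤ B1.aSeq a P.L k) {γ : ℝ} (hγ : 0 < γ)
    (hlow : ∀ w : ScalarField P 0 N, (∀ x, x ∉ Ω → w x = 0) →
      γ * ((P.mesh k)⁻¹ ^ 2) * siteInner w w ≤ siteInner w (covOpK C Ω A msq a k w))
    (hlow₀ : ∀ w : ScalarField P 0 N, (∀ x, x ∉ Ω₀ → w x = 0) →
      γ * ((P.mesh k)⁻¹ ^ 2) * siteInner w w ≤ siteInner w (covOpK C Ω₀ A msq a k w))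
    {δ : ℝ} (hδ0 : 0 ≤ δ) (hδ1 : δ ≤ 1) (hδ : 2 * (2 * P.d * δ ^ 2 + B1.aSeq a P.L k * (2 * δ)) ≤ γ)
    (M : ℕ) (hM : 1 ≤ M)
    (g : ScalarField P 0 N) (hgΩ : ∀ x, x ∉ Ω → g x = 0)
    (h' : HiggsLattice.PBond P 0 → E N) (hh' : ∀ b, ¬ Inside Ω b → h' b = 0) (ρ ρ' : ℝ)
    (hρ : ∀ x, g x ≠ 0 → ρ ≤ (distTo (Finset.univ.filter fun y : HiggsLattice.Site P 0 => y ∉ Ω) z₀ x : ℝ))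
    (hρ' : ∀ b, h' b ≠ 0 → ρ' ≤ (distTo (Finset.univ.filter fun y : HiggsLattice.Site P 0 => y ∉ Ω) z₀ b.src : ℝ)) :
    |siteInner g (propagatorK C Ω A msq a k (adjA C A h')) - siteInner g (propagatorK C Ω₀ A msq a k (adjA C A h'))|
      ≤ ((2 / Real.sqrt γ + 4 * Real.sqrt P.d * δ / γ) * (Real.exp δ + Real.exp δ ^ 3)
          + 1 / M * Real.sqrt P.d *
              (Real.exp δ ^ 2 * ((4 + 2 * δ * Real.sqrt (8 * P.d / γ)) * (2 / γ) + (2 / Real.sqrt γ + 4 * Real.sqrt P.d * δ / γ) ^ 2)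
                + 2 / γ)
          + 2 * (1 / M) * B1.aSeq a P.L k * (2 / Real.sqrt γ + 4 * Real.sqrt P.d * δ / γ) * Real.exp δ * (2 / γ))
        * Real.exp (2 * (δ * ((M : ℝ) + 3))) * P.mesh k
        * Real.exp (-(δ * (ρ / (P.L : ℝ) ^ k))) * Real.exp (-(δ * (ρ' / (P.L : ℝ) ^ k)))
        * Real.sqrt (siteInner g g) * Real.sqrt (bondInner h' h') := by
  classical
  set Z : Finset (HiggsLattice.Site P 0) := Finset.univ.filter fun y : HiggsLattice.Site P 0 => y ∉ Ω with hZdef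
  have hZΩ : ∀ y, y ∉ Ω → y ∈ Z := fun y hy => Finset.mem_filter.2 ⟨Finset.mem_univ _, hy⟩
  have hM' : (0 : ℝ) < M := by exact_mod_cast hM
  have hLk : (0 : ℝ) < (P.L : ℝ) ^ k := pow_pos (by exact_mod_cast P.hL) _
  set χ := cutoff Z z₀ M k with hχ
  have H := deltaG_pairing_GDt_of_cutoff C A hk Ω Ω₀ hΩ hΩ₀ hsub hmsq hak hγ hlow hlow₀ hδ0 hδ1 hδ χ
    (cutoff_nonneg Z z₀ M k) (cutoff_le_one Z z₀ M k)
    (fun b _ hb => cutoff_boundary_bond Z z₀ M k Ω hZΩ b hb)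
    (κ := 1 / ((M : ℝ) * (P.L : ℝ) ^ k)) (by positivity) (abs_cutoff_bond_le Z z₀ M k hM)
    (jumpBonds Z z₀ M k Ω) (fun b hb => inside_of_mem_jumpBonds Z z₀ M k Ω hb) (fun b hb hj => mem_jumpBonds Z z₀ M k Ω hb hj)
    (κ' := 1 / (M : ℝ)) (by positivity) (fun x x' h0 => abs_cutoff_block_le Z z₀ M k hM hk h0)
    (collarBlocks Z z₀ M k Ω) (fun x x' h0 hy => cutoff_const_off_collarBlocks Z z₀ M k Ω hM hΩ hZΩ h0 hy)
    (transition Z z₀ M k Ω) (fun x hx h0 => mem_transition_of_cutoff_ne_one Z z₀ M k Ω hM hx h0)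
    (fun b hb => src_mem_transition_of_mem_jumpBonds Z z₀ M k Ω hM hb) (fun x hx => (mem_transition_iff Z z₀ M k Ω x).2 hx)
    g hgΩ h' hh' (ρ - ((M : ℝ) + 3) * (P.L : ℝ) ^ k) (ρ' - ((M : ℝ) + 3) * (P.L : ℝ) ^ k)
    (fun x t hx ht => sep_of_le_distTo Z z₀ M k Ω hk (hρ x hx) ht)
    (fun b t hb ht => sep_of_le_distTo Z z₀ M k Ω hk (hρ' b hb) ht)
  obtain ⟨hκ, hexp⟩ := bookkeeping (P := P) (k := k) M hM δ
  rw [hκ, hexp ρ, hexp ρ'] at H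
  refine H.trans (le_of_eq ?_)
  have e2 : Real.exp (2 * (δ * ((M : ℝ) + 3))) = Real.exp (δ * ((M : ℝ) + 3)) * Real.exp (δ * ((M : ℝ) + 3)) := by
    rw [two_mul, Real.exp_add]
  rw [e2]
  ring

set_option maxHeartbeats 800000 in
/-- **[13] (1.11) / Cor. 2.3 (2.30) second sentence — the FOURTH `δG` pairing `⟨h, D^ε_A(G^ε_k(Ω,A) − G^ε_k(Ω₀,A))D^{ε*}_Ah′⟩` at a regular `A`
on the concrete carrier, PRINTED SHAPE up to the lattice normalisation of distances** (same data; `h, h′` on the bonds inside `Ω` with sources at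
lattice distance `≥ ρ, ρ′` from `Ωᶜ`): `|⟨h, D^ε_AδG D^{ε*}_Ah′⟩| ≤ C₃(M)·e^{2δ(M+3)}·e^{−δρ/L^k}e^{−δρ′/L^k}‖h‖‖h′‖` — no power of `L^kε`, uniform in `k`.
[cite: Balaban1983RegularityDecay, (1.11) p.573, Cor. 2.3 (2.30) pp.580–581] -/
theorem deltaG_pairing_DGDt_regular_region (C : ChargeData N) (A : HiggsLattice.VecField P 0) {msq a : ℝ} (hk : k ≤ P.K)
    (Ω Ω₀ : Finset (HiggsLattice.Site P 0))
    (hΩ : ∀ x x' : HiggsLattice.Site P 0, blockIter k x = blockIter k x' → (x ∈ Ω ↔ x' ∈ Ω))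
    (hΩ₀ : ∀ x x' : HiggsLattice.Site P 0, blockIter k x = blockIter k x' → (x ∈ Ω₀ ↔ x' ∈ Ω₀)) (hsub : Ω ⊆ Ω₀)
    (z₀ : (Finset.univ.filter fun y : HiggsLattice.Site P 0 => y ∉ Ω))
    (hmsq : 0 < msq) (hak : 0 ≤ B1.aSeq a P.L k) {γ : ℝ} (hγ : 0 < γ)
    (hlow : ∀ w : ScalarField P 0 N, (∀ x, x ∉ Ω → w x = 0) →
      γ * ((P.mesh k)⁻¹ ^ 2) * siteInner w w ≤ siteInner w (covOpK C Ω A msq a k w))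
    (hlow₀ : ∀ w : ScalarField P 0 N, (∀ x, x ∉ Ω₀ → w x = 0) →
      γ * ((P.mesh k)⁻¹ ^ 2) * siteInner w w ≤ siteInner w (covOpK C Ω₀ A msq a k w))
    {δ : ℝ} (hδ0 : 0 ≤ δ) (hδ1 : δ ≤ 1) (hδ : 2 * (2 * P.d * δ ^ 2 + B1.aSeq a P.L k * (2 * δ)) ≤ γ)
    (M : ℕ) (hM : 1 ≤ M)
    (h h' : HiggsLattice.PBond P 0 → E N) (hh : ∀ b, ¬ Inside Ω b → h b = 0) (hh' : ∀ b, ¬ Inside Ω b → h' b = 0) (ρ ρ' : ℝ)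
    (hρ : ∀ b, h b ≠ 0 → ρ ≤ (distTo (Finset.univ.filter fun y : HiggsLattice.Site P 0 => y ∉ Ω) z₀ b.src : ℝ))
    (hρ' : ∀ b, h' b ≠ 0 → ρ' ≤ (distTo (Finset.univ.filter fun y : HiggsLattice.Site P 0 => y ∉ Ω) z₀ b.src : ℝ)) :
    |bondInner h (covDeriv C A (propagatorK C Ω A msq a k (adjA C A h')))
        - bondInner h (covDeriv C A (propagatorK C Ω₀ A msq a k (adjA C A h')))|
      ≤ ((4 + 2 * δ * Real.sqrt (8 * P.d / γ)) * (Real.exp δ ^ 3 + Real.exp δ ^ 4)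
          + 1 / M * Real.sqrt P.d * (2 / Real.sqrt γ + 4 * Real.sqrt P.d * δ / γ) * Real.exp δ *
              (2 * (4 + 2 * δ * Real.sqrt (8 * P.d / γ)) * Real.exp δ ^ 2 + 2)
          + 2 * (1 / M) * B1.aSeq a P.L k * (2 / Real.sqrt γ + 4 * Real.sqrt P.d * δ / γ) ^ 2 * Real.exp δ ^ 2)
        * Real.exp (2 * (δ * ((M : ℝ) + 3)))
        * Real.exp (-(δ * (ρ / (P.L : ℝ) ^ k))) * Real.exp (-(δ * (ρ' / (P.L : ℝ) ^ k)))
        * Real.sqrt (bondInner h h) * Real.sqrt (bondInner h' h') := by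
  classical
  set Z : Finset (HiggsLattice.Site P 0) := Finset.univ.filter fun y : HiggsLattice.Site P 0 => y ∉ Ω with hZdef
  have hZΩ : ∀ y, y ∉ Ω → y ∈ Z := fun y hy => Finset.mem_filter.2 ⟨Finset.mem_univ _, hy⟩
  have hM' : (0 : ℝ) < M := by exact_mod_cast hM
  have hLk : (0 : ℝ) < (P.L : ℝ) ^ k := pow_pos (by exact_mod_cast P.hL) _
  set χ := cutoff Z z₀ M k with hχ
  have H := deltaG_pairing_DGDt_of_cutoff C A hk Ω Ω₀ hΩ hΩ₀ hsub hmsq hak hγ hlow hlow₀ hδ0 hδ1 hδ χ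
    (cutoff_nonneg Z z₀ M k) (cutoff_le_one Z z₀ M k)
    (fun b _ hb => cutoff_boundary_bond Z z₀ M k Ω hZΩ b hb)
    (κ := 1 / ((M : ℝ) * (P.L : ℝ) ^ k)) (by positivity) (abs_cutoff_bond_le Z z₀ M k hM)
    (jumpBonds Z z₀ M k Ω) (fun b hb => inside_of_mem_jumpBonds Z z₀ M k Ω hb) (fun b hb hj => mem_jumpBonds Z z₀ M k Ω hb hj)
    (κ' := 1 / (M : ℝ)) (by positivity) (fun x x' h0 => abs_cutoff_block_le Z z₀ M k hM hk h0)
    (collarBlocks Z z₀ M k Ω) (fun x x' h0 hy => cutoff_const_off_collarBlocks Z z₀ M k Ω hM hΩ hZΩ h0 hy)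
    (transition Z z₀ M k Ω) (fun x hx h0 => mem_transition_of_cutoff_ne_one Z z₀ M k Ω hM hx h0)
    (fun b hb => src_mem_transition_of_mem_jumpBonds Z z₀ M k Ω hM hb) (fun x hx => (mem_transition_iff Z z₀ M k Ω x).2 hx)
    h h' hh hh' (ρ - ((M : ℝ) + 3) * (P.L : ℝ) ^ k) (ρ' - ((M : ℝ) + 3) * (P.L : ℝ) ^ k)
    (fun b t hb ht => sep_of_le_distTo Z z₀ M k Ω hk (hρ b hb) ht)
    (fun b t hb ht => sep_of_le_distTo Z z₀ M k Ω hk (hρ' b hb) ht)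
  obtain ⟨hκ, hexp⟩ := bookkeeping (P := P) (k := k) M hM δ
  rw [hκ, hexp ρ, hexp ρ'] at H
  refine H.trans (le_of_eq ?_)
  have e2 : Real.exp (2 * (δ * ((M : ℝ) + 3))) = Real.exp (δ * ((M : ℝ) + 3)) * Real.exp (δ * ((M : ℝ) + 3)) := by
    rw [two_mul, Real.exp_add]
  rw [e2]
  ring

end Literature.MathematicalPhysics.QuantumFieldTheory.Balaban1983to89.B1DeltaGDerivCutoffPairing

end
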